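import Summits.Langlands.Langlands.Theorems.IrreducibilityBySelfDualityIrreducibleOffSectorRankFourTotallyReal
import Literature.NumberTheory.Automorphic.GL4NonSelfDualIrreducible
import HarnessLib

/-!
# `IrreducibleOffSector`, rank four over totally real fields, non-self-dual `π`: the region on the
# Literature NAMED FACT (Shavali 2026, Thm. A)
(crux stmt-Langlands-14329 `IrreducibilityBySelfDuality.IrreducibleOffSector`, line `Sketch`;
`--supports` file, STRUCTURAL: no import of the route module; continuation lead c6)

`…IrreducibleOffSectorRankFourTotallyReal` (p125438) proves the rank-four totally-real
non-essentially-self-dual region of the crux modulo the lang.S27 text and the TEXT `h4` of Shavali's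
Theorem A.  That text is now the Literature named fact
`Literature.NumberTheory.Automorphic.isIrreducible_galoisRep_gl4_totallyReal_of_not_essSelfDual`
(`GL4NonSelfDualIrreducible`, p125475), definitionally (`…_iff`, `Iff.rfl`); this file records the
region CONDITIONAL ON THE NAMED FACT (and the lang.S27 text), so that the trust base is a name of the
tree: `irreducibleOffSector_rank_four_totallyReal_of_fact`.

References: A. Shavali, arXiv:2603.19768 (2026), Thm. A, Cor. 4.6; M. Harris, K.-W. Lan, R. Taylor,
J. Thorne, Res. Math. Sci. 3 (2016), Thm. A.
-/

noncomputable section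

set_option linter.dupNamespace false

open scoped NumberField Classical
open Filter IsDedekindDomain NumberField
open Literature.NumberTheory.Automorphic Literature.NumberTheory.GaloisRepresentations
open Summit.Langlands

namespace Summit.Langlands.Langlands.Theorems.IrreducibleOffSector

/-- **The rank-four totally-real non-self-dual region of `IrreducibleOffSector`, on the named fact.**
Granting lang.S27 (the text of the route input `GaloisRepOfRegularAlgebraic`) and the Literature named
fact `isIrreducible_galoisRep_gl4_totallyReal_of_not_essSelfDual` (Shavali 2026, Thm. A = Cor. 4.6,
unrefereed): for `K` totally real and `π` cuspidal on `GL_4(𝔸_K)`, L-algebraic with a regular infinity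
type and not essentially self-dual at Satake level, every `ρ : Γ_K → GL_4(ℚ̄_ℓ)` Satake–Frobenius
compatible with `(π, ι)` a.e. is irreducible, for every `ℓ`, `ι`
(`irreducibleOffSector_rank_four_totallyReal_of_not_essSelfDual` with `h4` the fact, unfolded by
`isIrreducible_galoisRep_gl4_totallyReal_of_not_essSelfDual_iff`).
[claim: Shavali2026GL4, status: under-review] [cite: HarrisLanTaylorThorneRMS2016, Thm. A] -/
theorem irreducibleOffSector_rank_four_totallyReal_of_fact
    (hGR : ∀ (n : ℕ) (K : Type) [Field K] [NumberField K] (hcpt : Literature.NumberTheory.Automorphic.isCompact_glFiniteIntegralLevel n K), (NumberField.IsTotallyReal K ∨ NumberField.IsCMField K) → ∀ (π : Literature.NumberTheory.Automorphic.CuspidalAutomorphicRepData n K hcpt), π.1.IsRegularAlgebraic → ∀ (ℓ : ℕ) [Fact ℓ.Prime] (ι : PadicAlgCl ℓ ≃+* ℂ), ∃ r : Literature.NumberTheory.GaloisRepresentations.FramedGaloisRep K (PadicAlgCl ℓ) n, r.toGaloisRep.IsSemisimple ∧ ∀ (v : IsDedekindDomain.HeightOneSpectrum (NumberField.RingOfIntegers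 K)) (α : Multiset ℂ), π.1.HasSatakeParamAt v α → ((ℓ : ℕ) : NumberField.RingOfIntegers K) ∉ v.asIdeal → r.IsUnramifiedAt v ∧ r.HasFrobCharpolyAt v (Literature.NumberTheory.Automorphic.arithFrobPolyOfSatake ι v.residueCard n α))
    (h4 : isIrreducible_galoisRep_gl4_totallyReal_of_not_essSelfDual)
    {K : Type} [Field K] [NumberField K] (hK : IsTotallyReal K)
    (h1 : isCompact_glFiniteIntegralLevel 1 K) {hcpt : isCompact_glFiniteIntegralLevel 4 K}
    (π : CuspidalAutomorphicRepData 4 K hcpt) (hL : π.1.IsLAlgebraic)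
    (hreg : ∃ T : InfinityType K 4, π.1.HasInfinityType T ∧ T.IsRegular)
    (hnsd : ∀ η : CuspidalAutomorphicRepData 1 K h1,
      ¬ ∀ᶠ v : HeightOneSpectrum (𝓞 K) in cofinite, ∀ α : Multiset ℂ, π.1.HasSatakeParamAt v α →
        ∃ e : ℂ, η.1.HasSatakeParamAt v {e} ∧ α.map (fun a => a⁻¹) = α.map (fun a => e * a))
    {ℓ : ℕ} [Fact ℓ.Prime] (ι : PadicAlgCl ℓ ≃+* ℂ) (ρ : FramedGaloisRep K (PadicAlgCl ℓ) 4)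
    (hρ : ∀ᶠ v : HeightOneSpectrum (𝓞 K) in cofinite, SatakeFrobCompatibleAt ι π.1 ρ v) :
    ρ.toGaloisRep.IsIrreducible :=
  isIrreducible_rank_four_totallyReal_of_isRegular_of_not_essSelfDual hGR
    (isIrreducible_galoisRep_gl4_totallyReal_of_not_essSelfDual_iff.mp h4) hK h1 π hL hreg hnsd ι ρ hρ

end Summit.Langlands.Langlands.Theorems.IrreducibleOffSector

end
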